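import Mathlib.NumberTheory.Padics.RingHoms
import Mathlib.NumberTheory.Padics.ProperSpace
import Mathlib.Data.ZMod.QuotientGroup
import Mathlib.Data.Nat.Factors
import Mathlib.GroupTheory.PGroup
import Mathlib.Analysis.SpecificLimits.Normed
import Mathlib.Topology.Algebra.OpenSubgroup
import Mathlib.Topology.MetricSpace.Ultra.Basic
import Literature.AnabelianGeometry.SemiGraphs.Coverticial
import HarnessLib

/-!
# `ℤ_p` is the pro-`p` completion of `ℤ` (in the tree's `IsProSigmaCompletion` sense)

Classical fact (Serre, *Galois Cohomology* I §1.5; Ribes–Zalesskii, *Profinite Groups*, §3.3 free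
pro-`𝒞` groups of rank one): the additive group of `p`-adic integers, with the inclusion `ℤ → ℤ_p`, is
the pro-`p` completion of `ℤ` — `ℤ` is dense, every open subgroup of `ℤ_p` has `p`-power index, and
every subgroup `p^k ℤ ⊆ ℤ` of `p`-power index is the trace of the open subgroup `p^k ℤ_p`.
[cite: RibesZalesskii2010, §3.3]

abc-iut cell, layer L3, FRONTIER programme SUBDAG-REFUTE-F1732 (honest framing: «towards a kernel
erratum for the ∀-countable reading of [SemiAnbd] Thm 3.7 (iii) ([IUTchI] Rmk 2.5.3); desk countermodel
abc-iut-L3-d1 g3 memo 8b26b5199c29f55f; print proves finite `𝔾` (kernel: p431007)»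
[cite: MochizukiSemiAnbd2006, Thm 3.7(iii) pp.40-41]), brick **R1c (i)** (seat abc-iut-L3-t7 gen 5): the
EDGE GROUP `E = ℤ_p` of the sliding ray `𝒢_θ` as a pro-`{p}` completion in the currency of
abc-iut-L3-t1's `SemiGraphOfAnabelioids.IsProSigmaCompletion` ([SemiAnbd] Example 2.10), so that the
gluing `α : ℤ_p → F̂₂⁽ᵖ⁾`, `1 ↦ a` is produced by the tree's universal property
`IsProSigmaCompletion.exists_continuous_extend_profinite` (brick R1c (ii)).  PROOF-ONLY (no definition,
no named fact):

* `PadicInt.isSigmaInteger_index_of_isOpen` — open subgroups of (`Multiplicative`) `ℤ_p` have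
  `{p}`-integer (i.e. `p`-power) index (`pⁿ • x → 0`);
* `PadicInt.isProSigmaCompletion_intCast` — **`ℤ → ℤ_p` is a pro-`{p}` completion**.

Nothing here bears on [IUTchIII] Cor. 3.12.
-/

noncomputable section

open Topology Filter Multiplicative
open Literature.AnabelianGeometry.Anabelioids (IsSigmaInteger)
open Literature.AnabelianGeometry.SemiGraphs.SemiGraphOfAnabelioids (IsProSigmaCompletion)

namespace PadicInt

variable {p : ℕ} [hp : Fact p.Prime]

/-- `Multiplicative ℤ_[p]` is compact (the same space as `ℤ_[p]`). [cite: RibesZalesskii2010, §3.3] -/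
private theorem compactSpace_multiplicative : CompactSpace (Multiplicative ℤ_[p]) :=
  inferInstanceAs (CompactSpace ℤ_[p])

/-- **Open subgroups of `ℤ_p` have `p`-power index** (written for `Multiplicative ℤ_[p]`): the quotient
is a finite `p`-group since `pⁿ • x → 0` forces every class to have `p`-power order.
[cite: RibesZalesskii2010, §3.3] -/
theorem isSigmaInteger_index_of_isOpen (V : Subgroup (Multiplicative ℤ_[p]))
    (hV : IsOpen (V : Set (Multiplicative ℤ_[p]))) : IsSigmaInteger ({p} : Set ℕ) V.index := by
  classical
  haveI := compactSpace_multiplicative (p := p)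
  haveI : Finite (Multiplicative ℤ_[p] ⧸ V) := Subgroup.quotient_finite_of_isOpen V hV
  have hP : IsPGroup p (Multiplicative ℤ_[p] ⧸ V) := by
    intro q
    obtain ⟨x, rfl⟩ := QuotientGroup.mk_surjective q
    have h0 : Tendsto (fun n : ℕ => ((p : ℤ_[p]) ^ n)) atTop (𝓝 0) :=
      tendsto_pow_atTop_nhds_zero_of_norm_lt_one (by
        rw [PadicInt.norm_p]
        exact inv_lt_one_of_one_lt₀ (by exact_mod_cast hp.out.one_lt))
    have h1 : Tendsto (fun n : ℕ => ((p : ℤ_[p]) ^ n) * x.toAdd) atTop (𝓝 0) := by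
      simpa using h0.mul_const x.toAdd
    have ht : Tendsto (fun n : ℕ => ofAdd (((p : ℤ_[p]) ^ n) * x.toAdd)) atTop (𝓝 1) :=
      (continuous_ofAdd.tendsto _).comp h1
    have hmem : ∀ᶠ n : ℕ in atTop, ofAdd (((p : ℤ_[p]) ^ n) * x.toAdd) ∈ V :=
      ht (hV.mem_nhds V.one_mem)
    obtain ⟨n, hn⟩ := hmem.exists
    refine ⟨n, ?_⟩
    rw [← QuotientGroup.mk_pow, QuotientGroup.eq_one_iff]
    have hx : ofAdd (((p : ℤ_[p]) ^ n) * x.toAdd) = x ^ p ^ n := by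
      rw [← Nat.cast_pow, ← nsmul_eq_mul, ofAdd_nsmul, ofAdd_toAdd]
    rwa [← hx]
  obtain ⟨n, hn⟩ := IsPGroup.iff_card.mp hP
  rw [Subgroup.index_eq_card, hn]
  exact ⟨pow_pos hp.out.pos n,
    fun q hq hqd => (Nat.prime_dvd_prime_iff_eq hq hp.out).mp (hq.dvd_of_dvd_pow hqd)⟩

omit hp in
/-- A `{p}`-integer is a power of `p`. [cite: RibesZalesskii2010, §3.3] -/
private theorem exists_eq_prime_pow_of_isSigmaInteger {m : ℕ} (hm : IsSigmaInteger ({p} : Set ℕ) m) :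
    ∃ k : ℕ, m = p ^ k :=
  ⟨_, Nat.eq_prime_pow_of_unique_prime_dvd hm.1.ne' fun hd hdm => hm.2 _ hd hdm⟩

/-- The open subgroup `p^k ℤ_p` of `Multiplicative ℤ_[p]` (as the ideal `(p^k)` viewed
multiplicatively) is open: it is the closed ball of radius `p^{-k}`, open in the ultrametric `ℤ_p`.
[cite: RibesZalesskii2010, §3.3] -/
private theorem isOpen_toSubgroup_span_pow (k : ℕ) :
    IsOpen ((AddSubgroup.toSubgroup
      ((Ideal.span {(p : ℤ_[p]) ^ k} : Ideal ℤ_[p]).toAddSubgroup) :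
        Subgroup (Multiplicative ℤ_[p])) : Set (Multiplicative ℤ_[p])) := by
  have hset : ((AddSubgroup.toSubgroup
      ((Ideal.span {(p : ℤ_[p]) ^ k} : Ideal ℤ_[p]).toAddSubgroup) :
        Subgroup (Multiplicative ℤ_[p])) : Set (Multiplicative ℤ_[p])) =
      Multiplicative.toAdd ⁻¹' Metric.closedBall (0 : ℤ_[p]) ((p : ℝ) ^ (-k : ℤ)) := by
    ext x
    simp only [SetLike.mem_coe, Multiplicative.mem_toSubgroup, Set.mem_preimage, Metric.mem_closedBall,
      dist_zero_right]
    exact (norm_le_pow_iff_mem_span_pow _ k).symm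
  rw [hset]
  refine (IsUltrametricDist.isOpen_closedBall (0 : ℤ_[p]) ?_).preimage continuous_toAdd
  exact (zpow_pos (by exact_mod_cast hp.out.pos) _).ne'

/-- **`ℤ → ℤ_p` is a pro-`{p}` completion** in the sense of [SemiAnbd] Example 2.10 /
`SemiGraphOfAnabelioids.IsProSigmaCompletion` (written multiplicatively,
`ι := (Int.castAddHom ℤ_[p]).toMultiplicative`): dense image (`denseRange_intCast`), open subgroups of
`p`-power index, and every (normal) subgroup of `ℤ` of `p`-power index `p^k` — necessarily `p^k ℤ` — is
the trace of the open subgroup `p^k ℤ_p`.  Hence the universal property of the tree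
(`IsProSigmaCompletion.exists_continuous_extend_profinite`): every homomorphism `ℤ → B` into a profinite
pro-`p` group extends continuously to `ℤ_p`. [cite: RibesZalesskii2010, §3.3] -/
theorem isProSigmaCompletion_intCast :
    IsProSigmaCompletion ({p} : Set ℕ)
      (AddMonoidHom.toMultiplicative (Int.castAddHom ℤ_[p]) :
        Multiplicative ℤ →* Multiplicative ℤ_[p]) where
  dense := by
    -- `range ι = ofAdd '' range (Int.cast)`, dense by `denseRange_intCast`
    have h1 : DenseRange (fun n : ℤ => ofAdd ((n : ℤ_[p]))) :=
      (Multiplicative.ofAdd.surjective.denseRange.comp denseRange_intCast continuous_ofAdd)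
    have h2 : DenseRange (fun n : Multiplicative ℤ => ofAdd (((Multiplicative.toAdd n : ℤ) : ℤ_[p]))) :=
      h1.comp Multiplicative.toAdd.surjective.denseRange continuous_of_discreteTopology
    exact h2
  index_open := fun V _ hV => isSigmaInteger_index_of_isOpen V hV
  comap_surj := by
    intro N _ hN
    classical
    -- `[ℤ : N] = p^k`
    obtain ⟨k, hk⟩ := exists_eq_prime_pow_of_isSigmaInteger hN
    -- `K := p^k ℤ ≤ N` (every `m`-th power lies in a subgroup of index `m`), with the same index, so `K = N`
    let K : Subgroup (Multiplicative ℤ) :=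
      AddSubgroup.toSubgroup (AddSubgroup.zmultiples ((p : ℤ) ^ k))
    have hKN : K ≤ N := by
      intro x hx
      rw [Multiplicative.mem_toSubgroup, Int.mem_zmultiples_iff] at hx
      obtain ⟨c, hc⟩ := hx
      have h1 : x = ((ofAdd (1 : ℤ)) ^ N.index) ^ c := by
        rw [← ofAdd_nsmul, ← ofAdd_zsmul, ← ofAdd_toAdd x, hc, hk]
        congr 1
        simp only [nsmul_eq_mul, smul_eq_mul, mul_one]
        push_cast
        ring
      rw [h1]
      exact N.zpow_mem (Subgroup.pow_index_mem N (ofAdd (1 : ℤ))) c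
    have hKidx : K.index = p ^ k := by
      rw [AddSubgroup.index_toSubgroup, Int.index_zmultiples]
      simp
    have hKeq : K = N := by
      refine le_antisymm hKN ?_
      have h := Subgroup.relIndex_mul_index hKN
      rw [hKidx, ← hk] at h
      have hidx : N.index ≠ 0 := hN.1.ne'
      have hrel : K.relIndex N = 1 := by
        have : K.relIndex N * N.index = 1 * N.index := by rw [h, one_mul]
        exact Nat.eq_of_mul_eq_mul_right (Nat.pos_of_ne_zero hidx) this
      exact Subgroup.relIndex_eq_one.mp hrel
    -- `U := p^k ℤ_p`
    refine ⟨AddSubgroup.toSubgroup ((Ideal.span {(p : ℤ_[p]) ^ k} : Ideal ℤ_[p]).toAddSubgroup),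
      isOpen_toSubgroup_span_pow k, ?_⟩
    rw [← hKeq]
    ext x
    simp only [Subgroup.mem_comap, Multiplicative.mem_toSubgroup, K, Int.mem_zmultiples_iff]
    change ((Multiplicative.toAdd x : ℤ) : ℤ_[p]) ∈ (Ideal.span {(p : ℤ_[p]) ^ k} : Ideal ℤ_[p]) ↔ _
    rw [← norm_le_pow_iff_mem_span_pow, norm_int_le_pow_iff_dvd]

end PadicInt

end
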